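import Literature.IUT.LogVolume.ExplicitEstimatesCorollary52ProofKappa
import Literature.NumberTheory.DiophantineGeometry.FaltingsHeightJInvariantLobrich
import HarnessLib

/-!
# [ExpEst] Proposition 1.10 DISCHARGED: `theorem Prop110_holds : ExpEst.Prop110`, and the [ExpEst] chain
# with Prop. 1.10 no longer a hypothesis

S. Mochizuki, I. Fesenko, Y. Hoshi, A. Minamide, W. Porowski, *Explicit estimates in inter-universal
Teichmüller theory*, Kodai Math. J. **45** (2022) 175–236 — [ExpEst], bib key `MochizukiEtAl2022` (claim key,
status disputed) — **Proposition 1.10** (Comparison between `h(j(E))` and `h_Fal(E)`, I), p. 193 (pdf p. 19 of the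
cell render `run/shared/lean/pub/abc-iut/plan/repair/lit/renders/MFHMP-ExplicitEstimates-Kodai2022-book-anonnd-
eeiutp`, l. 6–14): "`0 ≤ (1/12)·h(j(E)) − h_Fal(E) ≤ (1/2)·log(1 + h(j(E))) + 2.071` … This follows immediately
from [10], Proposition 3.1" (`[10]` = Löbrich 2017). It was the ONE named fact of the [ExpEst] typing
(`ExpEst.Prop110`, `ExplicitEstimatesFaltingsComparisonEll.lean`, p496217: "a NAMED FACT, consumed as the
hypothesis `(h110 : Prop110)`; net debt +1, declared"). It is now a THEOREM of the tree:
`Literature.NumberTheory.DiophantineGeometry.FaltingsHeightLobrich.lobrich2017_prop32_stable` (Löbrich 2017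
Prop. 3.2 in stable form with the lower inequality of Prop. 3.1, PROVED from Mathlib's modular forms and
fundamental domain and the tree's Faltings-height formalism, with a per-embedding constant `log(65536 π¹²) ≈
24.8 < 12·2.071 + 6 log π`), whose statement is literally `Prop110Ineq (height P.W.j) (hFal P)` once
`height = logHeight₁/[F:ℚ]` (`height_eq_logHeight₁_div`) and `hFal = h^{stab} + ½ log π` (`hFal_eq`) are
unfolded. CLASSICAL material — nothing here takes a side on [IUTchIII] Cor. 3.12; no abc claim.

Consequently every theorem of the [ExpEst] chain that carried `(h110 : Prop110)` now holds without it; we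
record the chain's endpoints fed with `Prop110_holds` (the kernel reading of HOME/lit-abc-explicitiut/INDEX.md
becomes: {μ₆-[IUTchIII] Cor. 3.12 as applied on the Legendre family (`Thm51LegendreMu6`, DISPUTED claim) ∧
Dusart's `θ`-bound (`Dusart2010_theta_thm_5_2`, classical named fact)} ⟹ Cor. 5.2 ⟹ Thm. 5.3 (i) ⟹ Thm. 5.4
= `IUTDisputedClaim` ⟹ Cor. 5.8 / Cor. 5.9). Cell abc-iut, seat lit-abc-explicitiut (gen 6). Proof-only file.
-/

noncomputable section

namespace Literature.IUT.LogVolume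

namespace ExpEst

open Literature.NumberTheory.DiophantineGeometry Literature.NumberTheory.DiophantineGeometry.GenEll
open NumberField Cor22 IsDedekindDomain
open Literature.NumberTheory.LFunctions (Dusart2010_theta_thm_5_2)

/-! ## 1. Proposition 1.10 is a theorem -/

/-- **[ExpEst] Proposition 1.10, PROVED** (the named fact `ExpEst.Prop110` discharged): for every elliptic curve
`E` over a number field, "`0 ≤ (1/12)·h(j(E)) − h_Fal(E) ≤ (1/2)·log(1 + h(j(E))) + 2.071`" with `h` the Weil
height of Def. 1.1 (i) and `h_Fal = h^Fal + ½ log π` (§0 "Curves") — by Löbrich 2017 Prop. 3.2 / 3.1 as proved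
in `FaltingsHeightLobrich.lobrich2017_prop32_stable`. [cite: MochizukiEtAl2022, Prop 1.10 p. 193]
[cite: Lobrich2017, §3 Prop. 3.2 and Prop. 3.1] -/
theorem Prop110_holds : Prop110 := by
  unfold Prop110 Prop110Ineq
  intro P
  have h := FaltingsHeightLobrich.lobrich2017_prop32_stable P.F P.W
  rw [← div_eq_inv_mul] at h
  rw [height_eq_logHeight₁_div, hFal_eq]
  exact h

/-! ## 2. Corollary 1.14 for elliptic curves, now unconditional -/

/-- **[ExpEst] Corollary 1.14 (i)**, unconditional: for a presented semi-stable `E_F` with an `l`-cyclic subgroup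
scheme, `l` prime to the local heights at the places of multiplicative reduction, and `x > 0`,
"`(l/(12(1+x)))·h_non(j(E)) ≤ h_Fal(E) + (1/2)·log(l) + C(x)`" (`cor114_i_ell` fed with `Prop110_holds`).
[cite: MochizukiEtAl2022, Cor 1.14 (i) p. 194] -/
theorem cor114_i_ell' (P : EllPoint) (hss : P.IsSemistable) {l : ℕ} (hl : l.Prime)
    (hcyc : P.AdmitsLCyclic l)
    (hcop : ∀ v : HeightOneSpectrum (𝓞 P.F), P.W.HasMultiplicativeReductionAt v →
      ¬ ((l : ℤ) ∣ P.localHeight v)) {x : ℝ} (hx : 0 < x) :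
    (l : ℝ) / (12 * (1 + x)) * hNon P.W.j ≤ hFal P + 1 / 2 * Real.log l + C112 x :=
  cor114_i_ell Prop110_holds P hss hl hcyc hcop hx

/-- **[ExpEst] Corollary 1.14 (ii)**, unconditional: "`h_non(j(E)) ≤ 5·10⁻¹³ − 6.01·10⁻¹⁵·log(κ)`" for
`λ ∈ 𝒦_{𝕍(ℚ)^arc}(κ)`, `l ≥ 10^15` (`hNon_j_le_kappaLog` fed with `Prop110_holds`).
[cite: MochizukiEtAl2022, Cor 1.14 (ii) p. 195] -/
theorem hNon_j_le_kappaLog' (P : EllPoint) (hss : P.IsSemistable) {l : ℕ} (hl : l.Prime)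
    (hl15 : (10 : ℝ) ^ 15 ≤ l) (hcyc : P.AdmitsLCyclic l)
    (hcop : ∀ v : HeightOneSpectrum (𝓞 P.F), P.W.HasMultiplicativeReductionAt v →
      ¬ ((l : ℤ) ∣ P.localHeight v))
    (t : P.F) (h0 : t ≠ 0) (h1 : t ≠ 1) (hj : P.W.j = jInv t) {κ : ℝ} (hκ0 : 0 < κ) (hκ1 : κ ≤ 1)
    (hK : MemKArc κ ({ F := P.F, x := t } : NFPoint)) :
    hNon P.W.j ≤ kappaLog κ :=
  hNon_j_le_kappaLog Prop110_holds P hss hl hl15 hcyc hcop t h0 h1 hj hκ0 hκ1 hK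

/-- **[ExpEst] Corollary 1.14 (iii)**, unconditional: over a mono-complex `F`, "`h_non(j(E)) ≤ 5.12·10⁻¹³`"
(`hNon_j_le_of_isMonoComplex` fed with `Prop110_holds`). [cite: MochizukiEtAl2022, Cor 1.14 (iii) p. 195] -/
theorem hNon_j_le_of_isMonoComplex' (P : EllPoint) (hF : IsMonoComplex P.F)
    (hss : P.IsSemistable) {l : ℕ} (hl : l.Prime) (hl15 : (10 : ℝ) ^ 15 ≤ l) (hcyc : P.AdmitsLCyclic l)
    (hcop : ∀ v : HeightOneSpectrum (𝓞 P.F), P.W.HasMultiplicativeReductionAt v →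
      ¬ ((l : ℤ) ∣ P.localHeight v))
    (t : P.F) (h0 : t ≠ 0) (h1 : t ≠ 1) (hj : P.W.j = jInv t) :
    hNon P.W.j ≤ 5.12 / 10 ^ 13 :=
  hNon_j_le_of_isMonoComplex Prop110_holds P hF hss hl hl15 hcyc hcop t h0 h1 hj

/-! ## 3. The [ExpEst] chain from TWO named inputs: μ₆-Cor. 3.12 on the Legendre family (disputed) and Dusart -/

/-- **[ExpEst] Corollary 5.2 (both halves)** from the two remaining named inputs: the μ₆-[IUTchIII] Cor. 3.12
interface `Thm51LegendreMu6` (DISPUTED claim, hypothesis) and Dusart's bound (classical fact, hypothesis); Prop.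
1.10 is supplied by `Prop110_holds`. Conditional; nothing about abc is asserted.
[claim: MochizukiEtAl2022, status: disputed] -/
theorem corollary52_of_thm51LegendreMu6' (h51 : Thm51LegendreMu6) (hD : Dusart2010_theta_thm_5_2) {κ : ℝ}
    (hκ0 : 0 < κ) (hκ1 : κ ≤ 1) {d : ℕ} (hd1 : 1 ≤ d) {ε : ℝ} (hε0 : 0 < ε) (hε1 : ε ≤ 1) :
    PartKappa κ d ε ∧ PartMcx d ε :=
  corollary52_of_thm51LegendreMu6 h51 Prop110_holds hD hκ0 hκ1 hd1 hε0 hε1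

/-- **[ExpEst] Theorem 5.3 (i)** from the two named inputs (Prop. 1.10 supplied by `Prop110_holds`). Conditional.
[claim: MochizukiEtAl2022, status: disputed] -/
theorem thm53i_of_thm51LegendreMu6' (h51 : Thm51LegendreMu6) (hD : Dusart2010_theta_thm_5_2)
    {L : Type} [Field L] [NumberField L] {a b c : L} {ε : ℝ} (hε0 : 0 < ε) (hε1 : ε ≤ 1)
    (hmin : (NFPoint.mk L (-(a / c))).IsMinimal) : Thm53i L a b c ε :=
  thm53i_of_thm51LegendreMu6 h51 Prop110_holds hD hε0 hε1 hmin

/-- **[ExpEst] Theorem 5.3 (i) over `ℚ`** from the two named inputs. Conditional.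
[claim: MochizukiEtAl2022, status: disputed] -/
theorem thm53i_rat_of_thm51LegendreMu6' (h51 : Thm51LegendreMu6) (hD : Dusart2010_theta_thm_5_2)
    (a b c : ℚ) (ε : ℝ) : Thm53i ℚ a b c ε :=
  thm53i_rat_of_thm51LegendreMu6 h51 Prop110_holds hD a b c ε

/-- **[ExpEst] Theorem 5.4** = the record-only claim `Literature.Barriers.ABC.IUTDisputedClaim`, as a consequence
of the two named inputs (Prop. 1.10 supplied by `Prop110_holds`). Conditional: nothing is asserted about abc.
[claim: MochizukiEtAl2022, status: disputed] -/
theorem IUTDisputedClaim_of_thm51LegendreMu6' (h51 : Thm51LegendreMu6) (hD : Dusart2010_theta_thm_5_2) :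
    Literature.Barriers.ABC.IUTDisputedClaim :=
  IUTDisputedClaim_of_thm51LegendreMu6 h51 Prop110_holds hD

/-- **[ExpEst] Corollary 5.8** (FLT for prime exponents `> 1.615·10^14`) from the two named inputs. Conditional.
[claim: MochizukiEtAl2022, status: disputed] -/
theorem fermatLastTheoremFor_of_thm51LegendreMu6' (h51 : Thm51LegendreMu6) (hD : Dusart2010_theta_thm_5_2)
    {p : ℕ} (hp : p.Prime) (hbig : (1.615e14 : ℝ) < p) : FermatLastTheoremFor p :=
  fermatLastTheoremFor_of_thm51LegendreMu6 h51 Prop110_holds hD hp hbig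

/-- **[ExpEst] Corollary 5.9** (generalized Fermat) from the two named inputs. Conditional.
[claim: MochizukiEtAl2022, status: disputed] -/
theorem cor59_of_thm51LegendreMu6' (h51 : Thm51LegendreMu6) (hD : Dusart2010_theta_thm_5_2)
    (r s t : ℤ) (l m n : ℕ) : Cor59 r s t l m n :=
  cor59_of_thm51LegendreMu6 h51 Prop110_holds hD r s t l m n

end ExpEst

end Literature.IUT.LogVolume

end
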